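import Summits.Schanuel.Schanuel.Theorems.ZilberEacRotatingPowerLemmas
import HarnessLib

/-!
# THEOREM M: power coordinate of polynomial size with a ROTATING phase, fixed escape direction,
# log-drifting transversal

Zilber's Exponential-Algebraic Closedness, case ladder (host summit Schanuel, cell `pub-schanuel`,
seat 2, gen 12).  See `ZilberEacRotatingPowerLemmas` for the setting.  Along families

  `x_m = r_m + y_m q`,  `r_m - τ_m d → ρ₀`,  `τ_m → +∞`,  `y_m = e^{τ_m} Y_m` (`Y_m → y* ≠ 0`),
  `w_m = e^{λ τ_m} ζ^m C_m` (`C_m → C₀ ≠ 0`, `|ζ| = 1`, `ζ` not a root of unity),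

write `H(w_m, x_m) = Σ_{c,k,j} h_{c,k,j}(ρ_m) τ_m^j y_m^k w_m^c` (triple expansion).  The monomial
`(c,k,j)` has size `e^{(λc + k)τ} τ^j`; let `μ = max (λc + k)` over the support and `j*` the largest
`j` on the top class.  Dividing by `e^{μτ} τ^{j*}`, every monomial off the top class tends to `0`,
and the top class tends to the ROTATING SUM `Q(ζ^m) = Σ_c b_c ζ^{mc}`,
`b_c = h_{c,k(c),j*}(ρ₀) (y*)^{k(c)} C₀^c` — a nonzero polynomial `Q` evaluated along the
non-periodic rotation `ζ^m`, which cannot tend to `0` (`not_tendsto_norm_eval_pow_of_rotation`).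
Only the plain Zariski density of the limits `ρ₀` is needed (to make one `b_c ≠ 0`); `λ` is an
ARBITRARY real number — rational exponents, where THEOREMS I/J are silent, included.

* THEOREM M `eq_zero_of_rotating_power`; density form `unprojectedDense_of_rotating_power`.

Use: `ZilberEacHyperplaneSlowDensity` (real hyperplanes in the slow regime, ALL growth exponents).

HONEST FRAMING: an elimination lemma; `EC(3,2)` OPEN; nothing here bears on Schanuel's conjecture
(EAC ⇏ SC).
-/

noncomputable section

open MvPolynomial Filter Topology Finset Complex
open Literature.NumberTheory.Transcendental Literature.ModelTheory.Zilber

set_option linter.dupNamespace false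

namespace Summit.Schanuel.Schanuel.Theorems

/-! ## Part A. THEOREM M -/

section Rotating

variable {t : ℕ}

/-- **THEOREM M (all families).**  Fix directions `d, q ∈ ℂ^t`, a real exponent `λ`, a unimodular
`ζ` which is not a root of unity, and a set `U ⊆ ℂ^t` on which no nonzero polynomial vanishes
identically.  Suppose that for every `ρ₀ ∈ U` there are sequences with `τ_m → +∞`,
`r_m - τ_m d → ρ₀`, `y_m = e^{τ_m} Y_m` with `Y_m → y* ≠ 0`, `w_m = e^{λτ_m} ζ^m C_m` with
`C_m → C₀ ≠ 0`, and `H(w_m, r_m + y_m q) = 0` for all large `m`.  Then `H = 0`. (new) -/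
theorem eq_zero_of_rotating_power (H : MvPolynomial (Fin (t + 1)) ℂ) (d q : Fin t → ℂ) (lam : ℝ)
    {ζ : ℂ} (hζ1 : ‖ζ‖ = 1) (hroot : ∀ j : ℕ, 0 < j → ζ ^ j ≠ 1)
    {U : Set (Fin t → ℂ)} (hU : ∀ G : MvPolynomial (Fin t) ℂ, G ≠ 0 → ∃ ρ ∈ U, eval ρ G ≠ 0)
    (hseq : ∀ ρ₀ ∈ U, ∃ (w : ℕ → ℂ) (r : ℕ → Fin t → ℂ) (τ : ℕ → ℝ) (y Y C : ℕ → ℂ) (ys C₀ : ℂ),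
      Tendsto τ atTop atTop ∧
      Tendsto (fun m => r m - ((τ m : ℝ) : ℂ) • d) atTop (𝓝 ρ₀) ∧
      (∀ m, y m = exp ((τ m : ℝ) : ℂ) * Y m) ∧ Tendsto Y atTop (𝓝 ys) ∧ ys ≠ 0 ∧
      (∀ m, w m = exp (((lam * τ m : ℝ) : ℂ)) * ζ ^ m * C m) ∧ Tendsto C atTop (𝓝 C₀) ∧ C₀ ≠ 0 ∧
      ∀ᶠ m in atTop, eval (Fin.cons (w m) (r m + y m • q) : Fin (t + 1) → ℂ) H = 0) :
    H = 0 := by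
  classical
  by_contra hH
  set P := finSuccEquiv ℂ t H with hPdef
  have hP0 : P ≠ 0 := fun h => hH ((finSuccEquiv ℂ t).injective (by rw [← hPdef, h, map_zero]))
  -- the triple coefficient family `h (c,k,j)`
  obtain ⟨K, J, hK, hJ⟩ := exists_triple_degree_bounds P d q
  generalize hψ : (fun i => Polynomial.C (Polynomial.C (X i) + Polynomial.C (C (d i)) * Polynomial.X) +
      Polynomial.C (Polynomial.C (C (q i))) * Polynomial.X :
      Fin t → Polynomial (Polynomial (MvPolynomial (Fin t) ℂ))) = ψ at hK hJ
  have hexpand : ∀ (ρ : Fin t → ℂ) (τ' y' w' : ℂ), eval (Fin.cons w' (ρ + τ' • d + y' • q) : Fin (t + 1) → ℂ) H =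
      ∑ x ∈ range (P.natDegree + 1) ×ˢ (range (K + 1) ×ˢ range (J + 1)),
        eval ρ (((aeval ψ (P.coeff x.1)).coeff x.2.1).coeff x.2.2) * (τ' ^ x.2.2 * y' ^ x.2.1 * w' ^ x.1) := by
    intro ρ τ' y' w'
    have h := eval_cons_eq_triple_sum H d q ρ τ' y' w' (D := P.natDegree + 1) (K := K) (J := J)
      (by rw [← hPdef]; exact Nat.lt_succ_self _)
    rw [hψ] at h
    exact h hK hJ
  obtain ⟨h, hh⟩ : ∃ h : ℕ × (ℕ × ℕ) → MvPolynomial (Fin t) ℂ,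
    h = fun x => ((aeval ψ (P.coeff x.1)).coeff x.2.1).coeff x.2.2 := ⟨_, rfl⟩
  set box : Finset (ℕ × (ℕ × ℕ)) := range (P.natDegree + 1) ×ˢ (range (K + 1) ×ˢ range (J + 1))
    with hbox
  set S : Finset (ℕ × (ℕ × ℕ)) := box.filter fun x => h x ≠ 0 with hS
  -- `S` is nonempty
  have hSne : S.Nonempty := by
    have hne := aeval_doubleShift_ne_zero (P.coeff P.natDegree)
      (Polynomial.leadingCoeff_ne_zero.2 hP0) d q
    rw [hψ] at hne
    set G := aeval ψ (P.coeff P.natDegree) with hG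
    have hk : G.coeff G.natDegree ≠ 0 := Polynomial.leadingCoeff_ne_zero.2 hne
    have hj : (G.coeff G.natDegree).coeff (G.coeff G.natDegree).natDegree ≠ 0 :=
      Polynomial.leadingCoeff_ne_zero.2 hk
    refine ⟨(P.natDegree, (G.natDegree, (G.coeff G.natDegree).natDegree)), ?_⟩
    rw [hS, Finset.mem_filter, hbox, Finset.mem_product, Finset.mem_product]
    refine ⟨⟨Finset.mem_range.2 (Nat.lt_succ_self _), Finset.mem_range.2 (Nat.lt_succ_of_le (hK _)),
      Finset.mem_range.2 (Nat.lt_succ_of_le (hJ _ _))⟩, ?_⟩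
    rw [hh]
    exact hj
  -- the weight, the top class `μ`, the top `T`-degree `js` on it, the pivot `x₀`
  set ω : ℕ × (ℕ × ℕ) → ℝ := fun x => lam * x.1 + x.2.1 with hω
  obtain ⟨x₁, hx₁S, hx₁max⟩ := S.exists_max_image ω hSne
  set μ : ℝ := ω x₁ with hμ
  set S' : Finset (ℕ × (ℕ × ℕ)) := S.filter fun x => ω x = μ with hS'
  have hS'ne : S'.Nonempty := ⟨x₁, by rw [hS', Finset.mem_filter]; exact ⟨hx₁S, rfl⟩⟩
  obtain ⟨x₀, hx₀S', hx₀max⟩ := S'.exists_max_image (fun x => x.2.2) hS'ne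
  set js : ℕ := x₀.2.2 with hjs
  have hx₀S : x₀ ∈ S := (Finset.mem_filter.1 hx₀S').1
  have hx₀ω : ω x₀ = μ := (Finset.mem_filter.1 hx₀S').2
  have hx₀box : x₀ ∈ box := (Finset.mem_filter.1 hx₀S).1
  have hx₀h : h x₀ ≠ 0 := (Finset.mem_filter.1 hx₀S).2
  have hωle : ∀ x ∈ S, ω x ≤ μ := fun x hx => hx₁max x hx
  have hjle : ∀ x ∈ S, ω x = μ → x.2.2 ≤ js := fun x hx hωx =>
    hx₀max x (by rw [hS', Finset.mem_filter]; exact ⟨hx, hωx⟩)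
  -- the generic limit and the family
  obtain ⟨ρ₀, hρ₀U, hρ₀⟩ := hU (h x₀) hx₀h
  obtain ⟨w, r, τ, y, Y, C, ys, C₀, hτ, hρ, hy, hY, hys, hw, hC, hC₀, hzero⟩ := hseq ρ₀ hρ₀U
  obtain ⟨ρs, hρs⟩ : ∃ ρs : ℕ → Fin t → ℂ, ρs = fun m => r m - ((τ m : ℝ) : ℂ) • d := ⟨_, rfl⟩
  have hρs_lim : Tendsto ρs atTop (𝓝 ρ₀) := by rw [hρs]; exact hρ
  have hxm : ∀ m, r m + y m • q = ρs m + ((τ m : ℝ) : ℂ) • d + y m • q := by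
    intro m; rw [hρs]; dsimp only; abel
  -- the limiting coefficients `b` and the rotating sum `Q`
  obtain ⟨b, hb⟩ : ∃ b : ℕ × (ℕ × ℕ) → ℂ, b = fun x =>
    if x ∈ S ∧ ω x = μ ∧ x.2.2 = js then eval ρ₀ (h x) * ys ^ x.2.1 * C₀ ^ x.1 else 0 := ⟨_, rfl⟩
  set Q : Polynomial ℂ := ∑ x ∈ box, Polynomial.C (b x) * Polynomial.X ^ x.1 with hQ
  have hQeval : ∀ z : ℂ, Q.eval z = ∑ x ∈ box, b x * z ^ x.1 := by
    intro z
    rw [hQ, Polynomial.eval_finsetSum]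
    simp only [Polynomial.eval_mul, Polynomial.eval_C, Polynomial.eval_pow, Polynomial.eval_X]
  -- `b` vanishes off the pivot's `W`-power... more precisely: on `W`-power `x₀.1` only the pivot survives
  have hb_off : ∀ x ∈ box, x ≠ x₀ → x.1 = x₀.1 → b x = 0 := by
    intro x hx hne h1
    rw [hb]
    dsimp only
    rw [if_neg]
    rintro ⟨hxS, hxω, hxj⟩
    apply hne
    have hk : x.2.1 = x₀.2.1 := by
      have e : ω x = ω x₀ := by rw [hxω, hx₀ω]
      simp only [hω, h1] at e
      exact_mod_cast (add_left_cancel e)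
    exact Prod.ext h1 (Prod.ext hk (by rw [hxj]))
  have hbx₀ : b x₀ = eval ρ₀ (h x₀) * ys ^ x₀.2.1 * C₀ ^ x₀.1 := by
    rw [hb]; dsimp only; rw [if_pos ⟨hx₀S, hx₀ω, rfl⟩]
  have hQ0 : Q ≠ 0 := by
    intro hQz
    have hcoeff : Q.coeff x₀.1 = b x₀ := by
      rw [hQ, Polynomial.finsetSum_coeff]
      simp only [Polynomial.coeff_C_mul_X_pow]
      rw [Finset.sum_eq_single_of_mem x₀ hx₀box]
      · rw [if_pos rfl]
      · intro x hx hne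
        by_cases h1 : x₀.1 = x.1
        · rw [if_pos h1]; exact hb_off x hx hne h1.symm
        · rw [if_neg h1]
    rw [hQz, Polynomial.coeff_zero] at hcoeff
    have : b x₀ ≠ 0 := by
      rw [hbx₀]
      exact mul_ne_zero (mul_ne_zero hρ₀ (pow_ne_zero _ hys)) (pow_ne_zero _ hC₀)
    exact this hcoeff.symm
  -- ### the normalised terms
  obtain ⟨sc, hsc⟩ : ∃ sc : ℕ × (ℕ × ℕ) → ℕ → ℝ,
    sc = fun x m => Real.exp ((ω x - μ) * τ m) * τ m ^ x.2.2 / τ m ^ js := ⟨_, rfl⟩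
  obtain ⟨V, hV⟩ : ∃ V : ℕ × (ℕ × ℕ) → ℕ → ℂ,
    V = fun x m => eval (ρs m) (h x) * Y m ^ x.2.1 * C m ^ x.1 := ⟨_, rfl⟩
  have hVlim : ∀ x, Tendsto (V x) atTop (𝓝 (eval ρ₀ (h x) * ys ^ x.2.1 * C₀ ^ x.1)) := by
    intro x
    rw [hV]
    exact ((((MvPolynomial.continuous_eval (h x)).tendsto _).comp hρs_lim).mul (hY.pow _)).mul
      (hC.pow _)
  -- (1) exact identity: `(Σ_x V·sc·ζ^{mc}) · e^{μτ} τ^{js} = H(w_m, x_m)` for `τ_m > 0`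
  have hident : ∀ᶠ m in atTop,
      (∑ x ∈ box, V x m * ((sc x m : ℝ) : ℂ) * ζ ^ (m * x.1)) *
        (((Real.exp (μ * τ m) * τ m ^ js : ℝ)) : ℂ) =
      eval (Fin.cons (w m) (r m + y m • q) : Fin (t + 1) → ℂ) H := by
    filter_upwards [hτ.eventually_gt_atTop 0] with m hτ0
    rw [hxm m, hexpand (ρs m) _ _ _, Finset.sum_mul]
    refine Finset.sum_congr rfl fun x _ => ?_
    rw [show (((aeval ψ) (P.coeff x.1)).coeff x.2.1).coeff x.2.2 = h x by rw [hh]]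
    -- the scalar identity `sc · e^{μτ} τ^{js} = τ^j (e^τ)^k (e^{λτ})^c`
    have hreal : sc x m * (Real.exp (μ * τ m) * τ m ^ js) =
        τ m ^ x.2.2 * Real.exp (τ m) ^ x.2.1 * Real.exp (lam * τ m) ^ x.1 := by
      rw [hsc]
      dsimp only
      have hτjs : τ m ^ js ≠ 0 := pow_ne_zero _ hτ0.ne'
      rw [div_mul_eq_mul_div, div_eq_iff hτjs, ← Real.exp_nat_mul, ← Real.exp_nat_mul]
      have e1 : Real.exp ((ω x - μ) * τ m) * Real.exp (μ * τ m) =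
          Real.exp ((x.2.1 : ℕ) * τ m) * Real.exp ((x.1 : ℕ) * (lam * τ m)) := by
        rw [← Real.exp_add, ← Real.exp_add, hω]
        congr 1
        ring
      calc Real.exp ((ω x - μ) * τ m) * τ m ^ x.2.2 * (Real.exp (μ * τ m) * τ m ^ js)
          = (Real.exp ((ω x - μ) * τ m) * Real.exp (μ * τ m)) * τ m ^ x.2.2 * τ m ^ js := by ring
        _ = (Real.exp ((x.2.1 : ℕ) * τ m) * Real.exp ((x.1 : ℕ) * (lam * τ m))) * τ m ^ x.2.2 *
            τ m ^ js := by rw [e1]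
        _ = τ m ^ x.2.2 * Real.exp ((x.2.1 : ℕ) * τ m) * Real.exp ((x.1 : ℕ) * (lam * τ m)) *
            τ m ^ js := by ring
    have hC' : ((sc x m : ℝ) : ℂ) * (((Real.exp (μ * τ m) * τ m ^ js : ℝ)) : ℂ) =
        ((τ m : ℝ) : ℂ) ^ x.2.2 * exp ((τ m : ℝ) : ℂ) ^ x.2.1 * exp (((lam * τ m : ℝ)) : ℂ) ^ x.1 := by
      rw [← Complex.ofReal_mul, hreal]
      push_cast
      rfl
    rw [hV]
    dsimp only
    rw [hy m, hw m]
    calc eval (ρs m) (h x) * Y m ^ x.2.1 * C m ^ x.1 * ((sc x m : ℝ) : ℂ) * ζ ^ (m * x.1) *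
          (((Real.exp (μ * τ m) * τ m ^ js : ℝ)) : ℂ)
        = eval (ρs m) (h x) * Y m ^ x.2.1 * C m ^ x.1 * ζ ^ (m * x.1) *
          (((sc x m : ℝ) : ℂ) * (((Real.exp (μ * τ m) * τ m ^ js : ℝ)) : ℂ)) := by ring
      _ = eval (ρs m) (h x) * Y m ^ x.2.1 * C m ^ x.1 * ζ ^ (m * x.1) *
          (((τ m : ℝ) : ℂ) ^ x.2.2 * exp ((τ m : ℝ) : ℂ) ^ x.2.1 * exp (((lam * τ m : ℝ)) : ℂ) ^ x.1) := by
          rw [hC']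
      _ = eval (ρs m) (h x) * (((τ m : ℝ) : ℂ) ^ x.2.2 * (exp ((τ m : ℝ) : ℂ) * Y m) ^ x.2.1 *
          (exp (((lam * τ m : ℝ)) : ℂ) * ζ ^ m * C m) ^ x.1) := by
          rw [pow_mul]; ring
  -- (2) each normalised term tends to its rotating model
  have hterm : ∀ x ∈ box, Tendsto (fun m => V x m * ((sc x m : ℝ) : ℂ) * ζ ^ (m * x.1) -
      b x * ζ ^ (m * x.1)) atTop (𝓝 0) := by
    intro x hx
    -- it suffices that `V·sc → b x`
    suffices hVs : Tendsto (fun m => V x m * ((sc x m : ℝ) : ℂ)) atTop (𝓝 (b x)) by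
      rw [tendsto_zero_iff_norm_tendsto_zero]
      have h1 : Tendsto (fun m => ‖V x m * ((sc x m : ℝ) : ℂ) - b x‖) atTop (𝓝 0) := by
        rw [← tendsto_zero_iff_norm_tendsto_zero, ← sub_self (b x)]
        exact hVs.sub tendsto_const_nhds
      refine h1.congr fun m => ?_
      rw [← sub_mul, norm_mul, norm_pow, hζ1, one_pow, mul_one]
    by_cases hxS : x ∈ S
    · rcases lt_or_eq_of_le (hωle x hxS) with hlt | heq
      · -- off the top class: `sc → 0`
        have hb0 : b x = 0 := by
          rw [hb]; dsimp only; rw [if_neg]; rintro ⟨-, hωx, -⟩; exact hlt.ne hωx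
        rw [hb0]
        have hsc0 : Tendsto (sc x) atTop (𝓝 0) := by
          rw [hsc]
          exact tendsto_exp_mul_mul_pow_div_pow hτ (by linarith) _ _
        have h := (hVlim x).mul ((Complex.continuous_ofReal.tendsto 0).comp hsc0)
        rwa [Complex.ofReal_zero, mul_zero] at h
      · rcases lt_or_eq_of_le (hjle x hxS heq) with hjlt | hjeq
        · -- top class, lower `T`-degree: `sc = τ^j/τ^{js} → 0`
          have hb0 : b x = 0 := by
            rw [hb]; dsimp only; rw [if_neg]; rintro ⟨-, -, hj⟩; exact hjlt.ne hj
          rw [hb0]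
          have hsc0 : Tendsto (sc x) atTop (𝓝 0) := by
            rw [hsc]
            have h0 := tendsto_pow_div_pow_of_lt hτ hjlt
            refine h0.congr fun m => ?_
            dsimp only
            rw [heq, sub_self, zero_mul, Real.exp_zero, one_mul]
          have h := (hVlim x).mul ((Complex.continuous_ofReal.tendsto 0).comp hsc0)
          rwa [Complex.ofReal_zero, mul_zero] at h
        · -- the pivot class: `sc = 1` eventually
          have hb1 : b x = eval ρ₀ (h x) * ys ^ x.2.1 * C₀ ^ x.1 := by
            rw [hb]; dsimp only; rw [if_pos ⟨hxS, heq, hjeq⟩]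
          rw [hb1]
          refine (hVlim x).congr' ?_
          filter_upwards [hτ.eventually_gt_atTop 0] with m hτ0
          have hsc1 : sc x m = 1 := by
            rw [hsc]; dsimp only
            rw [heq, sub_self, zero_mul, Real.exp_zero, one_mul, hjeq, hjs,
              div_self (pow_ne_zero _ hτ0.ne')]
          rw [hsc1, Complex.ofReal_one, mul_one]
    · -- outside the support: the coefficient polynomial is zero
      have hh0 : h x = 0 := by
        by_contra hne
        exact hxS (Finset.mem_filter.2 ⟨hx, hne⟩)
      have hb0 : b x = 0 := by
        rw [hb]; dsimp only; rw [if_neg]; rintro ⟨hxS', -, -⟩; exact hxS hxS'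
      have hV0 : ∀ m, V x m = 0 := fun m => by rw [hV]; dsimp only; rw [hh0, map_zero, zero_mul, zero_mul]
      rw [hb0]
      refine tendsto_const_nhds.congr fun m => ?_
      rw [hV0, zero_mul]
  -- (3) the normalised sum vanishes eventually, so `Q(ζ^m) → 0`
  have hsum0 : ∀ᶠ m in atTop, ∑ x ∈ box, V x m * ((sc x m : ℝ) : ℂ) * ζ ^ (m * x.1) = 0 := by
    filter_upwards [hident, hzero, hτ.eventually_gt_atTop 0] with m hm hz hτ0
    rw [hz] at hm
    have hN : (((Real.exp (μ * τ m) * τ m ^ js : ℝ)) : ℂ) ≠ 0 := by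
      exact_mod_cast (mul_pos (Real.exp_pos _) (pow_pos hτ0 _)).ne'
    exact (mul_eq_zero.1 hm).resolve_right hN
  have hQlim : Tendsto (fun m : ℕ => ‖Q.eval (ζ ^ m)‖) atTop (𝓝 0) := by
    have hdiff : Tendsto (fun m => ∑ x ∈ box, (V x m * ((sc x m : ℝ) : ℂ) * ζ ^ (m * x.1) -
        b x * ζ ^ (m * x.1))) atTop (𝓝 0) := by
      have h := tendsto_finsetSum box fun x hx => hterm x hx
      rwa [Finset.sum_const_zero] at h
    rw [← tendsto_zero_iff_norm_tendsto_zero]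
    have hneg := hdiff.neg
    rw [neg_zero] at hneg
    refine hneg.congr' ?_
    filter_upwards [hsum0] with m hm
    rw [Finset.sum_sub_distrib, hm, zero_sub, neg_neg, hQeval]
    refine Finset.sum_congr rfl fun x _ => ?_
    rw [pow_mul]
  exact not_tendsto_norm_eval_pow_of_rotation hQ0 hζ1 hroot hQlim

end Rotating

/-! ## Part B. Density form -/

section Density

variable {n t : ℕ}

/-- **THEOREM M (density from a rotating power coordinate of polynomial size).**
`S ⊆ ℂⁿ × ℂⁿ` irreducible closed of dimension `≤ t + 1`, coordinates `c` and `β`, directions `d, q`,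
a real exponent `λ`, a unimodular `ζ` not a root of unity, and a set `U ⊆ ℂ^t` supporting no nonzero
polynomial.  If for every `ρ₀ ∈ U` there are exponential points `p_m ∈ S` (large `m`) whose
`c`-coordinates are `r_m + y_m q` with `r_m - τ_m d → ρ₀`, `τ_m → +∞`, `y_m = e^{τ_m}Y_m`, `Y_m → y* ≠ 0`,
and whose `β`-coordinate is `e^{λτ_m} ζ^m C_m` with `C_m → C₀ ≠ 0`, then `I(S ∩ Γ_exp) = I(S)`. (new) -/
theorem unprojectedDense_of_rotating_power {S : Set (Fin n ⊕ Fin n → ℂ)}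
    (hS : IsIrreducibleClosed ℂ S) (hdim : zariskiDim ℂ S ≤ ((t + 1 : ℕ) : WithBot ℕ∞))
    (c : Fin t → Fin n ⊕ Fin n) (β : Fin n ⊕ Fin n) (d q : Fin t → ℂ) (lam : ℝ)
    {ζ : ℂ} (hζ1 : ‖ζ‖ = 1) (hroot : ∀ j : ℕ, 0 < j → ζ ^ j ≠ 1)
    {U : Set (Fin t → ℂ)} (hU : ∀ G : MvPolynomial (Fin t) ℂ, G ≠ 0 → ∃ ρ ∈ U, eval ρ G ≠ 0)
    (hpts : ∀ ρ₀ ∈ U, ∃ (p : ℕ → Fin n ⊕ Fin n → ℂ) (r : ℕ → Fin t → ℂ) (τ : ℕ → ℝ)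
      (y Y C : ℕ → ℂ) (ys C₀ : ℂ),
      (∀ᶠ m : ℕ in atTop, p m ∈ S ∧ p m ∈ expGraph ℂ n) ∧
      (∀ᶠ m : ℕ in atTop, (fun i => p m (c i)) = r m + y m • q) ∧
      Tendsto τ atTop atTop ∧
      Tendsto (fun m => r m - ((τ m : ℝ) : ℂ) • d) atTop (𝓝 ρ₀) ∧
      (∀ m, y m = exp ((τ m : ℝ) : ℂ) * Y m) ∧ Tendsto Y atTop (𝓝 ys) ∧ ys ≠ 0 ∧
      (∀ᶠ m : ℕ in atTop, p m β = exp (((lam * τ m : ℝ)) : ℂ) * ζ ^ m * C m) ∧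
      Tendsto C atTop (𝓝 C₀) ∧ C₀ ≠ 0) :
    UnprojectedDense S := by
  refine unprojectedDense_of_no_relation hS hdim (Fin.cons β c) fun H hH0 => ?_
  by_contra hcon
  push Not at hcon
  apply hH0
  refine eq_zero_of_rotating_power H d q lam hζ1 hroot hU fun ρ₀ hρ₀ => ?_
  obtain ⟨p, r, τ, y, Y, C, ys, C₀, hpS, hcoord, hτ, hr, hy, hY, hys, hβ, hC, hC₀⟩ := hpts ρ₀ hρ₀
  refine ⟨fun m => exp (((lam * τ m : ℝ)) : ℂ) * ζ ^ m * C m, r, τ, y, Y, C, ys, C₀, hτ, hr, hy, hY,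
    hys, fun _ => rfl, hC, hC₀, ?_⟩
  filter_upwards [hpS, hcoord, hβ] with m hm hmc hmβ
  rw [← hmβ, ← hmc, ← comp_fin_cons]
  exact hcon (p m) hm

end Density

end Summit.Schanuel.Schanuel.Theorems

end
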